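import Summits.ValiantsHypothesis.ValiantsHypothesis.Theorems.ValuativeGCTValuativeBoundNegativeColumns

/-!
# `ValuativeBound` (stmt-ValiantsHypothesis-12625), negative side VII-a: the `Stab` torus and the
BALANCE of Stab-invariant forms (cdisprove, cycle 3)

The torus `x_{ab} ↦ s_a t_b x_{ab}` with `∏ s · ∏ t = 1` lies in `Stab(det_m)`
(`linSubst_torusDiag_detFormLex : det_m ∘ torusDiag s t = (∏ s)(∏ t) · det_m`), so the crux's Stab
clause forces every monomial of a degree-`mδ` Stab-invariant `G` on `End(ℂ^(m×m))` to have EXACTLY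
`δ` slots in each matrix row `a` and each matrix column `b` (`rowSlots_eq`, `colSlots_eq`; test
`s = 2` on `a`, `2⁻¹` on `a'`, compare coefficients).  Consumed by `…NegativeCompressionBlind`
(the valuative cut is blind on compression spaces). [folklore]
-/

namespace Summit.ValiantsHypothesis.Theorems.ValuativeBoundNegative

open MvPolynomial
open Literature.NumberTheory.DiophantineGeometry Literature.Computability.AlgebraicComplexity

section StabTorus

variable {m : ℕ}

/-! ### The `Stab` torus -/

/-- The torus substitution `x_{ab} ↦ s_a t_b x_{ab}` as a (diagonal) matrix on `MatIdx m`. -/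
def torusDiag (s t : Fin m → ℂ) : Matrix (MatIdx m) (MatIdx m) ℂ :=
  Matrix.diagonal fun l => s (ofLex l).1 * t (ofLex l).2

/-- `torusDiag` rescales each variable. -/
theorem linSubst_torusDiag_X (s t : Fin m → ℂ) (l : MatIdx m) :
    linSubst (MatIdx m) ℂ (torusDiag s t) (X l) = (s (ofLex l).1 * t (ofLex l).2) • (X l : MvPolynomial (MatIdx m) ℂ) := by
  classical
  rw [torusDiag, linSubst_X, Finset.sum_eq_single l]
  · rw [Matrix.diagonal_apply_eq]
  · intro j _ hj
    rw [Matrix.diagonal_apply_ne _ hj, zero_smul]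
  · intro h; exact absurd (Finset.mem_univ _) h

/-- **`det_m(diag(s)·x·diag(t)) = ∏ s · ∏ t · det_m(x)`** as a substitution identity. -/
theorem linSubst_torusDiag_detFormLex (s t : Fin m → ℂ) :
    linSubst (MatIdx m) ℂ (torusDiag s t) (detFormLex ℂ m) =
      C ((∏ a, s a) * ∏ b, t b) * detFormLex ℂ m := by
  classical
  rw [detFormLex, detPoly, AlgHom.map_det, AlgHom.map_det]
  have hmat : ((linSubst (MatIdx m) ℂ (torusDiag s t)).mapMatrix
      ((rename toLex : MvPolynomial (Fin m × Fin m) ℂ →ₐ[ℂ] _).mapMatrix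
        (Matrix.mvPolynomialX (Fin m) (Fin m) ℂ))) =
      Matrix.diagonal (fun a => C (s a)) *
        (rename toLex : MvPolynomial (Fin m × Fin m) ℂ →ₐ[ℂ] _).mapMatrix
          (Matrix.mvPolynomialX (Fin m) (Fin m) ℂ) * Matrix.diagonal (fun b => C (t b)) := by
    ext a b
    simp only [AlgHom.mapMatrix_apply, Matrix.map_apply, Matrix.mvPolynomialX_apply, rename_X,
      linSubst_torusDiag_X, ofLex_toLex, Matrix.mul_diagonal, Matrix.diagonal_mul, smul_eq_C_mul, map_mul]
    ring
  rw [hmat, Matrix.det_mul, Matrix.det_mul, Matrix.det_diagonal, Matrix.det_diagonal, ← map_prod, ← map_prod,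
    map_mul]
  ring

/-- Torus elements with `∏ s · ∏ t = 1` stabilise `det_m`. -/
theorem linSubst_torusDiag_detFormLex_of_eq_one {s t : Fin m → ℂ} (h : (∏ a, s a) * ∏ b, t b = 1) :
    linSubst (MatIdx m) ℂ (torusDiag s t) (detFormLex ℂ m) = detFormLex ℂ m := by
  rw [linSubst_torusDiag_detFormLex, h, map_one, one_mul]

/-- The Stab substitution at a torus element is the diagonal rescaling
`X (i, l) ↦ s_{a(l)} t_{b(l)} X (i, l)`. -/
theorem stabFun_torusDiag (s t : Fin m → ℂ) :
    (fun p : MatIdx m × MatIdx m => ∑ l : MatIdx m, torusDiag s t l p.2 •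
        (X (p.1, l) : MvPolynomial (MatIdx m × MatIdx m) ℂ)) =
      fun p => (s (ofLex p.2).1 * t (ofLex p.2).2) • X p := by
  classical
  funext p
  rw [Finset.sum_eq_single p.2]
  · rw [torusDiag, Matrix.diagonal_apply_eq]
  · intro l _ hl
    rw [torusDiag, Matrix.diagonal_apply_ne _ hl, zero_smul]
  · intro h; exact absurd (Finset.mem_univ _) h

/-! ### Balance: every monomial of a Stab-invariant form meets each matrix row and column `δ` times -/

/-- Test weights: `2` on `a`, `2⁻¹` on `a'`, `1` elsewhere. -/
noncomputable def twoAt (a a' : Fin m) (x : Fin m) : ℂ :=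
  if x = a then 2 else if x = a' then 2⁻¹ else 1

/-- `∏ twoAt a a' = 1` for `a ≠ a'`. -/
theorem prod_twoAt {a a' : Fin m} (h : a ≠ a') : ∏ x, twoAt a a' x = 1 := by
  classical
  have hsub : ({a, a'} : Finset (Fin m)) ⊆ Finset.univ := Finset.subset_univ _
  rw [← Finset.prod_sdiff hsub, Finset.prod_pair h]
  have h1 : ∏ x ∈ Finset.univ \ {a, a'}, twoAt a a' x = 1 := by
    refine Finset.prod_eq_one fun x hx => ?_
    simp only [Finset.mem_sdiff, Finset.mem_insert, Finset.mem_singleton, not_or] at hx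
    simp [twoAt, hx.2.1, hx.2.2]
  rw [h1, one_mul]
  simp [twoAt, h.symm]

/-- Core balance lemma: if `G` is fixed by the rescaling `X p ↦ twoAt a a' (κ p) • X p` for all
`a ≠ a'`, then on every monomial of `G` the `κ`-fibre sums of exponents are all equal. -/
theorem fibreSum_eq_of_invariant (κ : MatIdx m × MatIdx m → Fin m) {G : MvPolynomial (MatIdx m × MatIdx m) ℂ}
    (hinv : ∀ a a' : Fin m, a ≠ a' →
      MvPolynomial.aeval (fun p : MatIdx m × MatIdx m => twoAt a a' (κ p) • (X p : MvPolynomial _ ℂ)) G = G)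
    {e : MatIdx m × MatIdx m →₀ ℕ} (he : e ∈ G.support) (a a' : Fin m) :
    (∑ p ∈ Finset.univ.filter (fun p => κ p = a), e p) =
      ∑ p ∈ Finset.univ.filter (fun p => κ p = a'), e p := by
  classical
  by_cases haa : a = a'
  · rw [haa]
  have h := hinv a a' haa
  rw [aeval_smul_X_eq_linSubst_diagonal] at h
  have hc := congrArg (coeff e) h
  rw [coeff_linSubst_diagonal'] at hc
  have hce : coeff e G ≠ 0 := mem_support_iff.mp he
  have hprod : (∏ p : MatIdx m × MatIdx m, twoAt a a' (κ p) ^ e p) = 1 :=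
    mul_right_cancel₀ hce (hc.trans (one_mul _).symm)
  -- split the product along the fibres of `a`, `a'` and the rest
  set Sa := ∑ p ∈ Finset.univ.filter (fun p => κ p = a), e p with hSa
  set Sa' := ∑ p ∈ Finset.univ.filter (fun p => κ p = a'), e p with hSa'
  have hA : ∏ p ∈ Finset.univ.filter (fun p => κ p = a), twoAt a a' (κ p) ^ e p = 2 ^ Sa := by
    rw [hSa, ← Finset.prod_pow_eq_pow_sum]
    refine Finset.prod_congr rfl fun p hp => ?_
    rw [(Finset.mem_filter.mp hp).2]; simp [twoAt]
  have hA' : ∏ p ∈ Finset.univ.filter (fun p => κ p = a'), twoAt a a' (κ p) ^ e p = 2⁻¹ ^ Sa' := by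
    rw [hSa', ← Finset.prod_pow_eq_pow_sum]
    refine Finset.prod_congr rfl fun p hp => ?_
    rw [(Finset.mem_filter.mp hp).2]; simp [twoAt, Ne.symm haa]
  have hrest : ∏ p ∈ (Finset.univ.filter fun p => ¬ κ p = a).filter (fun p => ¬ κ p = a'),
      twoAt a a' (κ p) ^ e p = 1 := by
    refine Finset.prod_eq_one fun p hp => ?_
    simp only [Finset.mem_filter, Finset.mem_univ, true_and] at hp
    simp [twoAt, hp.1, hp.2]
  have hsplit : (∏ p : MatIdx m × MatIdx m, twoAt a a' (κ p) ^ e p) = 2 ^ Sa * 2⁻¹ ^ Sa' := by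
    rw [← Finset.prod_filter_mul_prod_filter_not Finset.univ (fun p => κ p = a), hA,
      ← Finset.prod_filter_mul_prod_filter_not (Finset.univ.filter fun p => ¬ κ p = a) (fun p => κ p = a'),
      hrest, mul_one]
    congr 1
    rw [← hA']
    refine Finset.prod_congr ?_ fun _ _ => rfl
    ext p
    simp only [Finset.mem_filter, Finset.mem_univ, true_and]
    constructor
    · rintro ⟨_, h2⟩; exact h2
    · intro h2; exact ⟨fun h1 => haa (h1.symm.trans h2), h2⟩
  rw [hsplit] at hprod
  have h2 : (2 : ℂ) ^ Sa = 2 ^ Sa' := by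
    have h3 : (2 : ℂ) ^ Sa * 2⁻¹ ^ Sa' * 2 ^ Sa' = 1 * 2 ^ Sa' := by rw [hprod]
    rwa [mul_assoc, ← mul_pow, inv_mul_cancel₀ (two_ne_zero' ℂ), one_pow, mul_one, one_mul] at h3
  by_contra hne
  exact two_pow_ne_two_pow hne h2

/-- Slots of the monomial `e` in matrix row `a` (second coordinate of the variable `X (i, (a, b))`). -/
def rowSlots (a : Fin m) (e : MatIdx m × MatIdx m →₀ ℕ) : ℕ :=
  ∑ p ∈ Finset.univ.filter (fun p : MatIdx m × MatIdx m => (ofLex p.2).1 = a), e p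

/-- Slots of the monomial `e` in matrix column `b`. -/
def colSlots (b : Fin m) (e : MatIdx m × MatIdx m →₀ ℕ) : ℕ :=
  ∑ p ∈ Finset.univ.filter (fun p : MatIdx m × MatIdx m => (ofLex p.2).2 = b), e p

/-- **Row balance** for Stab-invariants. -/
theorem rowSlots_eq_rowSlots {G : MvPolynomial (MatIdx m × MatIdx m) ℂ} (hS : G ∈ stabInvariants m)
    {e : MatIdx m × MatIdx m →₀ ℕ} (he : e ∈ G.support) (a a' : Fin m) : rowSlots a e = rowSlots a' e := by
  refine fibreSum_eq_of_invariant (fun p => (ofLex p.2).1) (fun a a' haa => ?_) he a a'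
  have h := (mem_stabInvariants_iff.mp hS) (torusDiag (twoAt a a') 1)
    (linSubst_torusDiag_detFormLex_of_eq_one (by rw [prod_twoAt haa]; simp))
  rw [stabFun_torusDiag] at h
  simpa only [Pi.one_apply, mul_one] using h

/-- **Column balance** for Stab-invariants. -/
theorem colSlots_eq_colSlots {G : MvPolynomial (MatIdx m × MatIdx m) ℂ} (hS : G ∈ stabInvariants m)
    {e : MatIdx m × MatIdx m →₀ ℕ} (he : e ∈ G.support) (b b' : Fin m) : colSlots b e = colSlots b' e := by
  refine fibreSum_eq_of_invariant (fun p => (ofLex p.2).2) (fun b b' hbb => ?_) he b b'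
  have h := (mem_stabInvariants_iff.mp hS) (torusDiag 1 (twoAt b b'))
    (linSubst_torusDiag_detFormLex_of_eq_one (by rw [prod_twoAt hbb]; simp))
  rw [stabFun_torusDiag] at h
  simpa only [Pi.one_apply, one_mul] using h

/-- The total number of slots is the degree. -/
theorem sum_univ_eq_of_mem_homogeneousSubmodule {n : ℕ} {G : MvPolynomial (MatIdx m × MatIdx m) ℂ}
    (hH : G ∈ MvPolynomial.homogeneousSubmodule (MatIdx m × MatIdx m) ℂ n)
    {e : MatIdx m × MatIdx m →₀ ℕ} (he : e ∈ G.support) : ∑ p, e p = n := by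
  have hdeg : e.degree = n := by
    rw [Finsupp.degree_eq_weight_one]
    exact (mem_homogeneousSubmodule n G).mp hH (mem_support_iff.mp he)
  rw [← hdeg, Finsupp.degree_eq_sum]

/-- **Exactly `δ` slots in every matrix row** (degree `mδ` Stab-invariants). -/
theorem rowSlots_eq {δ : ℕ} {G : MvPolynomial (MatIdx m × MatIdx m) ℂ}
    (hH : G ∈ MvPolynomial.homogeneousSubmodule (MatIdx m × MatIdx m) ℂ (m * δ))
    (hS : G ∈ stabInvariants m) {e : MatIdx m × MatIdx m →₀ ℕ} (he : e ∈ G.support) (a : Fin m) :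
    rowSlots a e = δ := by
  have htot : ∑ a' : Fin m, rowSlots a' e = m * δ := by
    rw [← sum_univ_eq_of_mem_homogeneousSubmodule hH he]
    exact Finset.sum_fiberwise Finset.univ (fun p : MatIdx m × MatIdx m => (ofLex p.2).1) e
  rw [Finset.sum_congr rfl (fun a' _ => rowSlots_eq_rowSlots hS he a' a), Finset.sum_const,
    Finset.card_univ, Fintype.card_fin, smul_eq_mul] at htot
  exact Nat.eq_of_mul_eq_mul_left (Fin.pos a) htot

/-- **Exactly `δ` slots in every matrix column.** -/
theorem colSlots_eq {δ : ℕ} {G : MvPolynomial (MatIdx m × MatIdx m) ℂ}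
    (hH : G ∈ MvPolynomial.homogeneousSubmodule (MatIdx m × MatIdx m) ℂ (m * δ))
    (hS : G ∈ stabInvariants m) {e : MatIdx m × MatIdx m →₀ ℕ} (he : e ∈ G.support) (b : Fin m) :
    colSlots b e = δ := by
  have htot : ∑ b' : Fin m, colSlots b' e = m * δ := by
    rw [← sum_univ_eq_of_mem_homogeneousSubmodule hH he]
    exact Finset.sum_fiberwise Finset.univ (fun p : MatIdx m × MatIdx m => (ofLex p.2).2) e
  rw [Finset.sum_congr rfl (fun b' _ => colSlots_eq_colSlots hS he b' b), Finset.sum_const,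
    Finset.card_univ, Fintype.card_fin, smul_eq_mul] at htot
  exact Nat.eq_of_mul_eq_mul_left (Fin.pos b) htot

end StabTorus

end Summit.ValiantsHypothesis.Theorems.ValuativeBoundNegative
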